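import Literature.Computability.FineGrained.FineGrainedWave0S04Reduction
import Literature.Computability.FineGrained.IPRenameCost
import HarnessLib

/-!
# Impagliazzo–Paturi's Theorem 3, `s_k ≤ (1 - d/k) s_∞`: the discharge

Family `fine-grained` (trunk T-CPLX-FINE); sibling proof file of `FineGrainedWave0.lean`
(D-0014), next to `FineGrainedWave0Proofs.lean`, `FineGrainedWave0S04Reduction.lean` and
`KSatExponentGapDischarge.lean`. The named fact

* `satExponent_le_satExponentLimit` (`FineGrainedWave0.lean`, **fine-grained.S04**;
  Impagliazzo–Paturi, JCSS 62 (2001), Theorem 3, p. 374: there is a constant `d > 0` with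
  `s_k ≤ (1 - d/k) s_∞` for all `k ≥ 3`, where `s_k = inf{δ : k-SAT is solvable in time
  O(2^{δ n})}` (p. 368) and `s_∞ = lim_k s_k`)

is PROVED here, closing the formalisation of the paper's main line
(sparsification ⟹ Lemma 2 ⟹ Theorem 3 ⟹ "`(s_k)` increases infinitely often assuming ETH").

Architecture of the printed proof (p. 374) and where each piece lives in the tree:

1. exhaustive search over the assignments with at most `δ n` ones, `h(δ) ≤ s_∞ / 2`
   (`lightKSAT_exhaustiveSearch_holds`, `LightSatMachine.lean`);
2. otherwise Lemma 2 (p. 373): `F` is equisatisfiable with a disjunction of at most `2^{2εn}`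
   `k'`-CNFs on at most `n (1 - δ/(ek))` variables, computable in time `poly(n) 2^{2εn}` —
   sparsification (`sparsification_holds`, `SparsificationAlgorithm.lean`; Impagliazzo–Paturi–Zane,
   JCSS 63 (2001), Thm 1), compaction (`Compaction.kCNF_compact_computable_holds`,
   `CompactionMachine.lean`) and the forced-variable renaming machine
   (`IPRenameM.ipRename_reduceList_computable_holds'`, `IPRenameCost.lean`, files
   `IPRename*.lean`), assembled in `IPLemma2Assembly.lean` / `IPLemma2MachineLift.lean`;
3. solve each disjunct with a `k'`-SAT algorithm of exponent `s_{k'} + ε ≤ s_∞ + ε`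
   (`kSATInExpTime_one_holds`, `SATBruteForceMachine.lean`, gives `s_j ≤ 1`, bounded exponent
   sets) and add up: `2^{h(δ)n} + 2^{2εn} poly + 2^{2εn} 2^{(s_∞+ε)(1-δ/(ek))n}
   ≤ 2^{(s_∞(1 - d/k) + 3ε)n}` with `d = δ/e` (the exponent bookkeeping:
   `satExponent_le_satExponentLimit_of`, `KSatExponentGap.lean`; with the machines plugged in:
   `satExponent_le_satExponentLimit_of_two_machines`, `KSatExponentGapProofs.lean`, and
   `satExponent_le_satExponentLimit_of_ipRename`, `FineGrainedWave0S04Reduction.lean`).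

This file only applies the last one-hypothesis reduction to the renaming-machine theorem. It is
a new leaf module (nothing imports it), joining the two acyclic import chains
`… → KSatExponentGapProofs → FineGrainedWave0S04Reduction` and
`… → IPLemma2MachineLift → IPRenameMain → IPRenameCost` exactly as
`KSatExponentGapDischarge.lean` does (which discharges Lemma 2 and the ETH consequence from the
same theorem). No new facts are introduced; no statement is changed.

## References

* R. Impagliazzo, R. Paturi, *On the complexity of k-SAT*, J. Comput. System Sci. 62 (2001)
  367–375, doi:10.1006/jcss.2000.1727: definitions of `s_k`, `s_∞` (p. 368), Lemma 2 (p. 373),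
  Theorem 3 and its proof (p. 374); abstract: "s_k ≤ (1 - d/k) s_∞ for some constant d > 0".
  [key `ImpagliazzoPaturiJCSS2001`] Conference version: *Complexity of k-SAT*, Proc. 14th IEEE
  CCC (1999) 237–240, doi:10.1109/ccc.1999.766282, Theorem 3.
* R. Impagliazzo, R. Paturi, F. Zane, *Which problems have strongly exponential complexity?*,
  J. Comput. System Sci. 63 (2001) 512–530, Theorem 1 / Corollary 1 (sparsification lemma).
-/

namespace Literature.Computability.FineGrained

/-- **Impagliazzo–Paturi 2001, Theorem 3** (discharge of the named fact
`satExponent_le_satExponentLimit`): there is a constant `d > 0` such that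
`s_k ≤ (1 - d/k) · s_∞` for every `k ≥ 3`. Proof: the one-hypothesis reduction
`satExponent_le_satExponentLimit_of_ipRename` (sparsification, compaction, light-assignment
search and brute force already plugged in as theorems) applied to the renaming machine
`IPRenameM.ipRename_reduceList_computable_holds'` (the "Moreover" sentence of Lemma 2).
[cite: ImpagliazzoPaturiJCSS2001, Theorem 3 (p. 374); Lemma 2 (p. 373)] -/
theorem satExponent_le_satExponentLimit_holds : satExponent_le_satExponentLimit :=
  satExponent_le_satExponentLimit_of_ipRename IPRenameM.ipRename_reduceList_computable_holds'

end Literature.Computability.FineGrained
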